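import Literature.Analysis.FluidPDE.PineauVicolCylinderRegularity
import Literature.Analysis.FluidPDE.PineauVicolRDSSLeray
import HarnessLib

/-!
# Lemma 7.1, (7.2), of Pineau–Vicol in Leray variables

Analysis/FluidPDE support file (all results proved; no named facts) in the discharge programme of
`Literature.Analysis.FluidPDE.pineauVicol2026_rdss_liouville` (B. Pineau, V. Vicol,
arXiv:2607.09619 (2026), Thm. 1.7). From the physical-variable bounds of
`PineauVicolCylinderRegularity` (`‖Dⁿₓu(t,·)(x)‖ ≤ K max{|x|,√(−t)}^{−(n+1)}` for classical
Type I solutions on `(−∞,0)`), the Leray profile `V(s,y) = e^{−s/2}u(−e^{−s}, e^{−s/2}y)` obeys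
`‖DⁿV(s,·)(y)‖ ≤ K / max{|y|,1}^{n+1}` for all `s`, `y`
(`exists_forall_iteratedFDeriv_lerayOrbit_le`; "each `y`-derivative contributes a factor
`e^{−s/2}`", `norm_iteratedFDeriv_zoom_le`) — the source's (7.2) with constants depending on
`C_{U,0}` and `n` only. The rotating profile `U(·,s) = R_{−αs}V(s, R_{αs}·)` of an RDSS
solution has the same derivative norms (`norm_iteratedFDeriv_rotZ_conj`).

## References

* B. Pineau, V. Vicol, arXiv:2607.09619 (2026), Lemma 7.1, (7.2) (p. 24). [PineauVicol2026]
-/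

noncomputable section

open MeasureTheory Set Function Filter Metric TopologicalSpace
open _root_.Topology
open scoped ENNReal NNReal InnerProductSpace RealInnerProductSpace Laplacian ContDiff

namespace Literature.Analysis.FluidPDE

namespace PineauVicol2026

section LerayBounds

/-- Local notation for physical space `ℝ³ = EuclideanSpace ℝ (Fin 3)`. -/
local notation "ℝ³" => EuclideanSpace ℝ (Fin 3)

-- nested operator types
set_option maxSynthPendingDepth 3

/-- **Zooming iterated derivatives**: for `f(y) = λ g(λ y)` with `g ∈ Cⁿ`, `λ ≥ 0`,
`‖Dⁿf(y)‖ ≤ λ^{n+1} ‖Dⁿg(λ y)‖`. [folklore] -/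
theorem norm_iteratedFDeriv_zoom_le {F : Type*} [NormedAddCommGroup F] [NormedSpace ℝ F]
    {g : ℝ³ → F} {n : ℕ} (hg : ContDiff ℝ n g) {lam : ℝ} (hlam : 0 ≤ lam) (y : ℝ³) :
    ‖iteratedFDeriv ℝ n (fun y => lam • g (lam • y)) y‖ ≤ lam ^ (n + 1) * ‖iteratedFDeriv ℝ n g (lam • y)‖ := by
  set L : ℝ³ →L[ℝ] ℝ³ := lam • ContinuousLinearMap.id ℝ ℝ³ with hL
  have hLn : ‖L‖ ≤ lam := by
    rw [hL]; refine (norm_smul_le _ _).trans ?_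
    rw [Real.norm_of_nonneg hlam]
    exact mul_le_of_le_one_right hlam ContinuousLinearMap.norm_id_le
  have hcomp : ContDiff ℝ n (g ∘ L) := hg.comp L.contDiff
  have hLapp : ∀ y, L y = lam • y := fun y => by simp [hL]
  have e0 : (fun y => lam • g (lam • y)) = lam • (g ∘ L) := by
    funext y; simp only [Pi.smul_apply, Function.comp_apply, hLapp]
  have e1 : iteratedFDeriv ℝ n (fun y => lam • g (lam • y)) y =
      lam • (iteratedFDeriv ℝ n g (L y)).compContinuousLinearMap fun _ => L := by
    rw [e0, iteratedFDeriv_const_smul_apply hcomp.contDiffAt, L.iteratedFDeriv_comp_right hg _ le_rfl]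
  rw [e1, hLapp, norm_smul, Real.norm_of_nonneg hlam, pow_succ, mul_comm (lam ^ n), mul_assoc]
  refine mul_le_mul_of_nonneg_left ?_ hlam
  refine (ContinuousMultilinearMap.norm_compContinuousLinearMap_le _ _).trans ?_
  rw [Finset.prod_const, Finset.card_univ, Fintype.card_fin, mul_comm]
  exact mul_le_mul_of_nonneg_right (pow_le_pow_left₀ (norm_nonneg _) hLn n) (norm_nonneg _)

/-- **Lemma 7.1, (7.2), in Leray variables.** For every `n` and `C₀` there is `K = K(n, C₀)` such
that for every classical solution `(u, p)` of Navier–Stokes (`ν = 1`, `f = 0`) on `(−∞, 0)` with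
the Type I bound `|u(x,t)| ≤ C₀/(|x| + √(−t))`, the Leray profile
`V(s, y) = e^{−s/2} u(−e^{−s}, e^{−s/2} y)` obeys `‖Dⁿ_y V(s,·)(y)‖ ≤ K / max{|y|, 1}^{n+1}` for
all `s`, `y` (the source's `|∇ᵏU| ≤ C_{U,k}/(1+|y|^{k+1})`, up to the rotation, which is
harmless: `V = R_{αs} U(R_{−αs} ·, s)`). [cite: PineauVicol2026, Lemma 7.1, (7.2)] -/
theorem exists_forall_iteratedFDeriv_lerayOrbit_le (n : ℕ) (C₀ : ℝ) :
    ∃ K : ℝ, 0 ≤ K ∧ ∀ (u : ℝ → ℝ³ → ℝ³) (p : ℝ → ℝ³ → ℝ),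
      FluidPDE.IsClassicalNSSolutionOn (Iio 0) 1 0 u p →
      (∀ t ∈ Iio (0 : ℝ), ∀ x, ‖u t x‖ ≤ C₀ / (‖x‖ + Real.sqrt (-t))) →
      ∀ (s : ℝ) (y : ℝ³),
        ‖iteratedFDeriv ℝ n (lerayOrbit u s) y‖ ≤ K * ((max ‖y‖ 1)⁻¹) ^ (n + 1) := by
  obtain ⟨K, hK0, hK⟩ := exists_forall_iteratedFDeriv_le_of_typeI n C₀
  refine ⟨K, hK0, fun u p hsol hI s y => ?_⟩
  set lam : ℝ := Real.exp (-s / 2) with hlam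
  have hlam0 : 0 < lam := Real.exp_pos _
  set t : ℝ := -Real.exp (-s) with ht
  have ht0 : t < 0 := by rw [ht]; exact neg_neg_of_pos (Real.exp_pos _)
  have hsqrt : Real.sqrt (-t) = lam := by rw [ht, neg_neg, hlam, sqrt_exp_neg]
  have hV : lerayOrbit u s = fun y => lam • u t (lam • y) := by
    funext y; rw [lerayOrbit_apply]
  have hut : ContDiff ℝ n (u t) := (hsol.contDiff_velocity (mem_Iio.2 ht0)).of_le (by exact_mod_cast le_top)
  have h1 := norm_iteratedFDeriv_zoom_le hut hlam0.le y
  rw [← hV] at h1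
  have h2 := hK u p hsol hI t (mem_Iio.2 ht0) (lam • y)
  rw [hsqrt, norm_smul, Real.norm_of_nonneg hlam0.le] at h2
  -- `max (λ|y|) λ = λ max(|y|, 1)`
  have hmax : max (lam * ‖y‖) lam = lam * max ‖y‖ 1 := by
    rw [mul_max_of_nonneg _ _ hlam0.le, mul_one]
  rw [hmax, mul_inv, mul_pow] at h2
  have hM0 : 0 < max ‖y‖ 1 := lt_max_of_lt_right one_pos
  calc ‖iteratedFDeriv ℝ n (lerayOrbit u s) y‖ ≤ lam ^ (n + 1) * ‖iteratedFDeriv ℝ n (u t) (lam • y)‖ := h1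
    _ ≤ lam ^ (n + 1) * (K * (lam⁻¹ ^ (n + 1) * (max ‖y‖ 1)⁻¹ ^ (n + 1))) :=
        mul_le_mul_of_nonneg_left h2 (by positivity)
    _ = K * (max ‖y‖ 1)⁻¹ ^ (n + 1) * (lam * lam⁻¹) ^ (n + 1) := by rw [mul_pow]; ring
    _ = K * (max ‖y‖ 1)⁻¹ ^ (n + 1) := by rw [mul_inv_cancel₀ hlam0.ne', one_pow, mul_one]

/-- **Rotating a field conjugates its Taylor coefficients by isometries**: for
`W(y) = R_θ V(R_{−θ}… )` — precisely `W = rotZ θ ∘ V ∘ rotZ φ` — and `V ∈ Cⁿ`,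
`‖DⁿW(y)‖ = ‖DⁿV(R_φ y)‖`. [folklore] -/
theorem norm_iteratedFDeriv_rotZ_conj {V : ℝ³ → ℝ³} {n : ℕ} (hV : ContDiff ℝ n V) (θ φ : ℝ) (y : ℝ³) :
    ‖iteratedFDeriv ℝ n (fun y => rotZ θ (V (rotZ φ y))) y‖ = ‖iteratedFDeriv ℝ n V (rotZ φ y)‖ := by
  have e : (fun y => rotZ θ (V (rotZ φ y))) = (rotZLIE θ).toLinearIsometry ∘ (V ∘ (rotZLIE φ)) := by
    funext y; simp [Function.comp_apply]
  rw [e, LinearIsometry.norm_iteratedFDeriv_comp_left _ (hV.comp (rotZLIE φ).contDiff).contDiffAt le_rfl]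
  exact (rotZLIE φ).norm_iteratedFDeriv_comp_right V y n

end LerayBounds

end PineauVicol2026

end Literature.Analysis.FluidPDE
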